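import Mathlib
import Literature.MathematicalPhysics.QuantumFieldTheory.MirrorHalfSpaceClusters
import HarnessLib

/-!
# Mirror OS data from configuration-level hypotheses; rescaling and flipping the normal

Topic `Literature/MathematicalPhysics/QuantumFieldTheory`.  Two supplements to
`MirrorHalfSpaceClusters.lean` (`MirrorOSData S n`: the kernel-level Osterwalder–Schrader
hypotheses of a correlation family `S` in the frame of a hyperplane mirror `n^⊥`).

* `mirrorOSData_of_bounds` — the two analytic fields of `MirrorOSData` (kernel entries bounded
  under time shifts, jointly continuous under shifts) follow from CONFIGURATION-level properties of
  `S`: vanishing on non-injective configurations, an a priori bound `|S_N(x)| ≤ B(N, r)` whenever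
  all pairwise distances of `x` are `≥ r > 0` (e.g. Gaussian domination), and continuity of each
  `S_N` on the non-coincident configurations.  The point is the uniform separation of the
  configurations `θ_n a ⊔ (b + t n)`, `t ≥ 0`: reflected and unreflected points are separated by the
  mirror (`(⟪aᵢ, n⟫ + ⟪bⱼ, n⟫)/‖n‖`), points within a block keep their distances.
* `clusterRP_smul_normal` — reflection positivity over half-space clusters for the normal `c • n`,
  `c ≠ 0`, from that for `n` (for `c < 0` the half-space flips; reflect all clusters and use
  `θ_n`-invariance of `S`), and `mirrorOSData_smul_normal_iff`-type transport of the other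
  hypotheses (`reflectionInvariant_smul_normal`).

All folklore (Osterwalder–Schrader 1973 §4.1; Glimm–Jaffe 1987 §6.1).
-/

noncomputable section

open scoped InnerProductSpace BigOperators
open Literature.Probability.LatticeModels Finset

namespace Literature.MathematicalPhysics.QuantumFieldTheory

variable {d : ℕ} {S : CorrFamily d} {n : EuclideanSpace ℝ (Fin d)}

/-! ### Separation of the configurations `θ_n a ⊔ (b + v)` -/

/-- The distance of a reflected point from a translated unreflected one is at least the sum of the
heights over the mirror divided by `‖n‖`: `‖θ_n x - (y + v)‖ ≥ (⟪x, n⟫ + ⟪y, n⟫)/‖n‖` for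
`⟪v, n⟫ ≥ 0`. [folklore] -/
theorem heights_div_norm_le_norm_reflection_sub (hn : n ≠ 0) {x y v : EuclideanSpace ℝ (Fin d)}
    (hx : 0 < ⟪x, n⟫_ℝ) (hy : 0 < ⟪y, n⟫_ℝ) (hv : 0 ≤ ⟪v, n⟫_ℝ) :
    (⟪x, n⟫_ℝ + ⟪y, n⟫_ℝ) / ‖n‖ ≤ ‖(ℝ ∙ n)ᗮ.reflection x - (y + v)‖ := by
  have hnorm : 0 < ‖n‖ := norm_pos_iff.2 hn
  rw [div_le_iff₀ hnorm]
  have hcs := abs_real_inner_le_norm ((ℝ ∙ n)ᗮ.reflection x - (y + v)) n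
  have hinner : ⟪(ℝ ∙ n)ᗮ.reflection x - (y + v), n⟫_ℝ = -(⟪x, n⟫_ℝ + ⟪y, n⟫_ℝ + ⟪v, n⟫_ℝ) := by
    rw [inner_sub_left, inner_add_left, inner_mirrorReflection_normal]; ring
  rw [hinner, abs_neg, abs_of_nonneg (by linarith)] at hcs
  linarith

/-- **Uniform separation.**  For half-space clusters `a, b` with injective points there is `r > 0`
such that for every `v` with `⟪v, n⟫ ≥ 0` all pairwise distances of the configuration
`θ_n a ⊔ (b + v)` are `≥ r`. [folklore] -/
theorem exists_separation (hn : n ≠ 0) (a b : HalfSpaceCluster d n) (ha : Function.Injective a.pts)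
    (hb : Function.Injective b.pts) :
    ∃ r : ℝ, 0 < r ∧ ∀ v : EuclideanSpace ℝ (Fin d), 0 ≤ ⟪v, n⟫_ℝ →
      ∀ i j : Fin (a.k + b.k), i ≠ j →
        r ≤ ‖Fin.append (fun i => (ℝ ∙ n)ᗮ.reflection (a.pts i)) (fun j => b.pts j + v) i -
          Fin.append (fun i => (ℝ ∙ n)ᗮ.reflection (a.pts i)) (fun j => b.pts j + v) j‖ := by
  classical
  -- the finite set of lower bounds
  set D : Finset ℝ :=
    ((Finset.univ.filter fun p : Fin a.k × Fin a.k => p.1 ≠ p.2).image fun p => ‖a.pts p.1 - a.pts p.2‖) ∪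
    ((Finset.univ.filter fun p : Fin b.k × Fin b.k => p.1 ≠ p.2).image fun p => ‖b.pts p.1 - b.pts p.2‖) ∪
    ((Finset.univ : Finset (Fin a.k × Fin b.k)).image fun p => (⟪a.pts p.1, n⟫_ℝ + ⟪b.pts p.2, n⟫_ℝ) / ‖n‖)
    with hD
  have hnorm : 0 < ‖n‖ := norm_pos_iff.2 hn
  have hDpos : ∀ r ∈ D, 0 < r := by
    intro r hr
    simp only [hD, Finset.mem_union, Finset.mem_image, Finset.mem_filter, Finset.mem_univ, true_and] at hr
    rcases hr with (⟨p, hp, rfl⟩ | ⟨p, hp, rfl⟩) | ⟨p, rfl⟩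
    · exact norm_pos_iff.2 (sub_ne_zero.2 fun h => hp (ha h))
    · exact norm_pos_iff.2 (sub_ne_zero.2 fun h => hp (hb h))
    · exact div_pos (add_pos (a.pos _) (b.pos _)) hnorm
  set r : ℝ := if hD' : D.Nonempty then D.min' hD' else 1 with hr
  have hrpos : 0 < r := by
    rw [hr]; split_ifs with hD'
    · exact hDpos _ (Finset.min'_mem D hD')
    · exact one_pos
  have hrle : ∀ x ∈ D, r ≤ x := by
    intro x hx
    rw [hr, dif_pos ⟨x, hx⟩]
    exact Finset.min'_le D x hx
  refine ⟨r, hrpos, fun v hv i j hij => ?_⟩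
  induction i using Fin.addCases with
  | left i =>
    induction j using Fin.addCases with
    | left j =>
      simp only [Fin.append_left, ← map_sub, LinearIsometryEquiv.norm_map]
      refine hrle _ ?_
      simp only [hD, Finset.mem_union, Finset.mem_image, Finset.mem_filter, Finset.mem_univ, true_and]
      exact Or.inl (Or.inl ⟨(i, j), fun h => hij (by cases h; rfl), rfl⟩)
    | right j =>
      simp only [Fin.append_left, Fin.append_right]
      refine (hrle _ ?_).trans (heights_div_norm_le_norm_reflection_sub hn (a.pos i) (b.pos j) hv)
      simp only [hD, Finset.mem_union, Finset.mem_image, Finset.mem_univ, true_and]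
      exact Or.inr ⟨(i, j), rfl⟩
  | right i =>
    induction j using Fin.addCases with
    | left j =>
      simp only [Fin.append_left, Fin.append_right, norm_sub_rev (b.pts i + v)]
      refine (hrle _ ?_).trans (heights_div_norm_le_norm_reflection_sub hn (a.pos j) (b.pos i) hv)
      simp only [hD, Finset.mem_union, Finset.mem_image, Finset.mem_univ, true_and]
      exact Or.inr ⟨(j, i), rfl⟩
    | right j =>
      simp only [Fin.append_right, add_sub_add_right_eq_sub]
      refine hrle _ ?_
      simp only [hD, Finset.mem_union, Finset.mem_image, Finset.mem_filter, Finset.mem_univ, true_and]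
      exact Or.inl (Or.inr ⟨(i, j), fun h => hij (by cases h; rfl), rfl⟩)

/-- The configuration `θ_n a ⊔ (b + v)` is injective for injective half-space clusters and
`⟪v, n⟫ ≥ 0`. [folklore] -/
theorem append_injective (hn : n ≠ 0) (a b : HalfSpaceCluster d n) (ha : Function.Injective a.pts)
    (hb : Function.Injective b.pts) {v : EuclideanSpace ℝ (Fin d)} (hv : 0 ≤ ⟪v, n⟫_ℝ) :
    Function.Injective (Fin.append (fun i => (ℝ ∙ n)ᗮ.reflection (a.pts i)) (fun j => b.pts j + v)) := by
  obtain ⟨r, hr, hsep⟩ := exists_separation hn a b ha hb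
  intro i j hij
  by_contra hne
  have := hsep v hv i j hne
  rw [hij, sub_self, norm_zero] at this
  linarith

/-- If one of the clusters has a repeated point, the configuration `θ_n a ⊔ (b + v)` is not
injective. [folklore] -/
theorem not_injective_append (a b : HalfSpaceCluster d n) (h : ¬ (Function.Injective a.pts ∧ Function.Injective b.pts))
    (v : EuclideanSpace ℝ (Fin d)) :
    ¬ Function.Injective (Fin.append (fun i => (ℝ ∙ n)ᗮ.reflection (a.pts i)) (fun j => b.pts j + v)) := by
  intro hinj
  apply h
  rw [Fin.append_injective_iff] at hinj
  exact ⟨fun i j hij => hinj.1 (by simp [hij]), fun i j hij => hinj.2.1 (by simp [hij])⟩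

/-! ### `MirrorOSData` from configuration-level bounds -/

/-- **OS data of a mirror from configuration-level hypotheses.**  Let `n ≠ 0` and let `S` be
reflection positive over the half-space clusters of `n`, `θ_n`-, permutation- and
translation-invariant, vanish on non-injective configurations, satisfy an a priori bound
`|S_N(x)| ≤ B(N, r)` whenever the points of `x` are pairwise `≥ r > 0` apart, and have every `S_N`
continuous on the non-coincident configurations.  Then `S` carries `MirrorOSData` in the frame
`n` (the kernel entries `K(a, b + t n)` are bounded by `B(|a|+|b|, r_{ab})`, resp. vanish, and
`(t, s) ↦ K(a, b + s n' + (t∨0) n)` is continuous). [folklore] -/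
theorem mirrorOSData_of_bounds (hn : n ≠ 0)
    (hRP : ∀ (m : ℕ) (k : Fin m → ℕ) (x : (a : Fin m) → Fin (k a) → EuclideanSpace ℝ (Fin d))
      (c : Fin m → ℝ), (∀ a i, 0 < ⟪x a i, n⟫_ℝ) →
      0 ≤ ∑ a, ∑ b, c a * c b * S (k a + k b) (Fin.append (fun i => (ℝ ∙ n)ᗮ.reflection (x a i)) (x b)))
    (hrefl : ∀ (N : ℕ) (x : Fin N → EuclideanSpace ℝ (Fin d)), S N (fun i => (ℝ ∙ n)ᗮ.reflection (x i)) = S N x)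
    (hperm : IsPermutationSymmetric S) (htrans : IsTranslationInvariant S)
    (hvanish : ∀ (N : ℕ) (x : Fin N → EuclideanSpace ℝ (Fin d)), ¬ Function.Injective x → S N x = 0)
    (hbdd : ∃ Bd : ℕ → ℝ → ℝ, ∀ (N : ℕ) (x : Fin N → EuclideanSpace ℝ (Fin d)) (r : ℝ), 0 < r →
      (∀ i j, i ≠ j → r ≤ ‖x i - x j‖) → |S N x| ≤ Bd N r)
    (hcont : ∀ N, ContinuousOn (S N) (NonCoincident d N)) :
    MirrorOSData S n where
  normal_ne_zero := hn
  reflectionPositive := hRP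
  reflectionInvariant := hrefl
  symmetric := hperm
  translationInvariant := htrans
  kernel_bdd a b := by
    obtain ⟨Bd, hBd⟩ := hbdd
    by_cases hinj : Function.Injective a.pts ∧ Function.Injective b.pts
    · obtain ⟨r, hr, hsep⟩ := exists_separation hn a b hinj.1 hinj.2
      refine ⟨Bd (a.k + b.k) r, fun t ht h => ?_⟩
      exact hBd _ _ r hr (hsep (t • n) h)
    · refine ⟨0, fun t ht h => ?_⟩
      simp only [mirrorKernel, HalfSpaceCluster.translate_k, HalfSpaceCluster.translate_pts]
      rw [hvanish _ _ (not_injective_append a b hinj _), abs_zero]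
  kernel_cont n' hn' a b := by
    by_cases hinj : Function.Injective a.pts ∧ Function.Injective b.pts
    · have hcfg : Continuous fun p : ℝ × ℝ => Fin.append (fun i => (ℝ ∙ n)ᗮ.reflection (a.pts i))
          (fun j => b.pts j + (p.2 • n' + max p.1 0 • n)) := by
        refine continuous_pi fun i => ?_
        induction i using Fin.addCases with
        | left i => simp only [Fin.append_left]; exact continuous_const
        | right j => simp only [Fin.append_right]; fun_prop
      have hmem : ∀ p : ℝ × ℝ, Fin.append (fun i => (ℝ ∙ n)ᗮ.reflection (a.pts i))
          (fun j => b.pts j + (p.2 • n' + max p.1 0 • n)) ∈ NonCoincident d (a.k + b.k) := fun p =>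
        append_injective hn a b hinj.1 hinj.2 (HalfSpaceCluster.inner_shiftVec_nonneg hn' p.1 p.2)
      exact (hcont (a.k + b.k)).comp_continuous hcfg hmem
    · have : (fun p : ℝ × ℝ => mirrorKernel S n a (HalfSpaceCluster.shift n' hn' p.1 p.2 b)) = fun _ => 0 := by
        funext p
        exact hvanish _ _ (not_injective_append a b hinj _)
      rw [this]
      exact continuous_const

/-! ### Rescaling and flipping the normal -/

/-- `θ_{c n}`-invariance from `θ_n`-invariance (`c ≠ 0`; the reflections agree). [folklore] -/
theorem reflectionInvariant_smul_normal
    (hrefl : ∀ (N : ℕ) (x : Fin N → EuclideanSpace ℝ (Fin d)), S N (fun i => (ℝ ∙ n)ᗮ.reflection (x i)) = S N x)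
    {c : ℝ} (hc : c ≠ 0) (N : ℕ) (x : Fin N → EuclideanSpace ℝ (Fin d)) :
    S N (fun i => (ℝ ∙ (c • n))ᗮ.reflection (x i)) = S N x := by
  simp only [mirrorReflection_smul_normal hc]
  exact hrefl N x

/-- **Reflection positivity over half-space clusters for a rescaled or flipped normal.**  If `S` is
reflection positive over the half-space clusters of `n` and `θ_n`-invariant, then it is reflection
positive over the half-space clusters of `c • n` for every `c ≠ 0` (for `c < 0` the clusters lie in
the opposite half-space: reflect them all and use `θ_n`-invariance). [folklore] -/
theorem clusterRP_smul_normal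
    (hRP : ∀ (m : ℕ) (k : Fin m → ℕ) (x : (a : Fin m) → Fin (k a) → EuclideanSpace ℝ (Fin d))
      (c : Fin m → ℝ), (∀ a i, 0 < ⟪x a i, n⟫_ℝ) →
      0 ≤ ∑ a, ∑ b, c a * c b * S (k a + k b) (Fin.append (fun i => (ℝ ∙ n)ᗮ.reflection (x a i)) (x b)))
    (hrefl : ∀ (N : ℕ) (x : Fin N → EuclideanSpace ℝ (Fin d)), S N (fun i => (ℝ ∙ n)ᗮ.reflection (x i)) = S N x)
    {c : ℝ} (hc : c ≠ 0) (m : ℕ) (k : Fin m → ℕ) (x : (a : Fin m) → Fin (k a) → EuclideanSpace ℝ (Fin d))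
    (coef : Fin m → ℝ) (hx : ∀ a i, 0 < ⟪x a i, c • n⟫_ℝ) :
    0 ≤ ∑ a, ∑ b, coef a * coef b *
      S (k a + k b) (Fin.append (fun i => (ℝ ∙ (c • n))ᗮ.reflection (x a i)) (x b)) := by
  simp only [mirrorReflection_smul_normal hc]
  simp only [real_inner_smul_right] at hx
  rcases lt_or_gt_of_ne hc with hneg | hpos
  · -- `c < 0`: reflect all clusters
    have hx' : ∀ a i, 0 < ⟪(ℝ ∙ n)ᗮ.reflection (x a i), n⟫_ℝ := fun a i => by
      rw [inner_mirrorReflection_normal]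
      have := hx a i
      nlinarith
    have h := hRP m k (fun a i => (ℝ ∙ n)ᗮ.reflection (x a i)) coef hx'
    simp only [Submodule.reflection_reflection] at h
    have key : ∀ a b, S (k a + k b) (Fin.append (fun i => (ℝ ∙ n)ᗮ.reflection (x a i)) (x b)) =
        S (k a + k b) (Fin.append (fun i => x a i) fun i => (ℝ ∙ n)ᗮ.reflection (x b i)) := by
      intro a b
      rw [← hrefl (k a + k b) (Fin.append (fun i => x a i) fun i => (ℝ ∙ n)ᗮ.reflection (x b i))]
      congr 1
      funext i
      refine Fin.addCases (fun j => ?_) (fun j => ?_) i <;> simp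
    simp only [key]
    exact h
  · exact hRP m k x coef fun a i => pos_of_mul_pos_right (by simpa [mul_comm] using hx a i) hpos.le

end Literature.MathematicalPhysics.QuantumFieldTheory
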